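import Literature.Barriers.FinalStateConjecture.ExtremalHorizonShellEnergyDecay
import HarnessLib

/-!
# Barrier catalogue `FinalStateConjecture`: the first Hardy inequality at the extremal horizon
# (Aretakis 2012, Prop. 4.4.1), one-dimensional core and shell form
# (`Literature/Barriers/FinalStateConjecture/`, D-0021, D-0014; family `gr`)

Written from the proving seat of `Literature.Barriers.FinalStateConjecture.Aretakis2012_pointwiseDecay`
(Aretakis, JFA 263 (2012), Thm. 5), whose remaining input after
`ExtremalHorizonPointwiseDecayFromEnergy.lean` is the pair of energy estimates Thms. 1–2 of the
source. In the proof of Thm. 2 (§13.1) the zeroth-order (Lagrangian) terms of the modified current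
`J^{N,−1/2}` (`Geometry/Lorentzian/KerrStarHorizonCurrent.lean`) are absorbed by the **Hardy
inequalities of §4.4**, of which the first reads `∫_{Σ_τ} ψ²/r² ≤ C ∫_{Σ_τ} (Δ/r²)((Tψ)² + (Yψ)²)`,
`Δ = (r − M)²` on extremal Kerr (Prop. 4.4.1, "immediately generalising" the extreme
Reissner–Nordström version of Aretakis 2011). This file proves its mechanism in the catalogue's
vocabulary, for functions vanishing on an outer sphere (the situation of the class after
`Kerr.fderiv_shellPoint_eq_zero_of_far` / `Kerr.eq_zero_of_far`, `ExtremalHorizonFiniteSpeed.lean`):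

* `Kerr.intervalIntegral_sq_le_four_mul` (**one-dimensional Hardy inequality, degenerate weight at
  the left end**): `∫_a^b g² ≤ 4∫_a^b (x − a)² g'²` if `g(b) = 0` (integrate `((x − a)g²)'`,
  `−2(x − a)gg' ≤ ½g² + 2(x − a)²g'²`);
* `Kerr.horizonSphereSq_le_layer` (**second Hardy inequality, Prop. 4.4.2, shell form**):
  `∫∫ sin θ Φ(p_τ)² ≤ (2/δ)∫∫∫_M^{M+δ} sin θ Φ² + 2δ ∫∫∫_M^{M+δ} sin θ (∂_ρΦ)²` for every `δ > 0` (the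
  trace estimate `Kerr.sq_le_average_of_hasDerivAt` integrated over the sphere);
* `Kerr.shellIntegral_sq_le_four_mul_degenerate` (**shell form on the Kerr–Schild leaves**): for
  `Φ ∈ C¹(E4)` with `Φ = 0` on `{r = R} ∩ {t* = τ}`,
  `∫₀^{2π}∫₀^π∫_M^R sin θ Φ² ≤ 4 ∫₀^{2π}∫₀^π∫_M^R sin θ (r − M)²(∂_ρΦ)²` (`∂_ρΦ = dΦ(p)(0, n̂)` along the
  `r`-lines of the leaf, `Kerr.hasDerivAt_comp_shellPoint`).

Everything is proved; no named facts. (The printed weights `1/r²`, needed on all of `Σ_τ` for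
non-compactly supported functions, are irrelevant on bounded shells `M ≤ r ≤ R`.)

## References

* S. Aretakis, *Decay of axisymmetric solutions of the wave equation on extreme Kerr backgrounds*,
  J. Funct. Anal. 263 (2012) 2770–2831 (arXiv:1110.2006): §4.4, Prop. 4.4.1 (first Hardy
  inequality), Prop. 4.4.2 (second Hardy inequality); §13.1 (their use) (key `Aretakis2012`).
* S. Aretakis, Comm. Math. Phys. 307 (2011) 17–63, §6 (the Hardy inequalities on extreme
  Reissner–Nordström), cited through Aretakis 2012, §4.4.
-/

noncomputable section

open Set Filter MeasureTheory intervalIntegral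
open scoped Topology ContDiff

namespace Literature.Barriers.FinalStateConjecture.Kerr

open Literature.Geometry.Lorentzian

/-! ### The one-dimensional Hardy inequality with the degenerate weight `(x − a)²` -/

/-- **One-dimensional Hardy inequality (degenerate weight at the left end).** If `g` has the
continuous derivative `g'` on `[a, b]` and `g(b) = 0`, then `∫_a^b g² ≤ 4 ∫_a^b (x − a)² g'²`:
integrate `((x − a)g²)' = g² + 2(x − a)gg'` and use `−2(x − a)gg' ≤ ½g² + 2(x − a)²g'²`. This is
the core of Aretakis's first Hardy inequality (`Δ = (r − M)²` on extremal Kerr).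
[cite: Aretakis2012, §4.4 (Prop. 4.4.1)] -/
theorem intervalIntegral_sq_le_four_mul {g g' : ℝ → ℝ} {a b : ℝ} (hab : a ≤ b)
    (hg : ∀ x ∈ Icc a b, HasDerivAt g (g' x) x) (hg' : ContinuousOn g' (Icc a b)) (hb : g b = 0) :
    ∫ x in a..b, g x ^ 2 ≤ 4 * ∫ x in a..b, (x - a) ^ 2 * g' x ^ 2 := by
  have hgc : ContinuousOn g (Icc a b) := fun x hx ↦ (hg x hx).continuousAt.continuousWithinAt
  -- `∫ ((x − a) g²)' = 0`
  have hfun : (fun x ↦ (x - a) * g x ^ 2) = fun x ↦ (x - a) * (g x * g x) := by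
    funext x; ring
  have hprod : ∀ x ∈ uIcc a b, HasDerivAt (fun x ↦ (x - a) * g x ^ 2)
      (g x ^ 2 + 2 * (x - a) * g x * g' x) x := by
    intro x hx
    rw [uIcc_of_le hab] at hx
    have h1 : HasDerivAt (fun x : ℝ ↦ x - a) 1 x := (hasDerivAt_id x).sub_const a
    have h := h1.fun_mul ((hg x hx).fun_mul (hg x hx))
    rw [hfun]
    refine h.congr_deriv ?_
    ring
  have hi1 : IntervalIntegrable (fun x ↦ g x ^ 2) volume a b := (hgc.pow 2).intervalIntegrable_of_Icc hab
  have hi2 : IntervalIntegrable (fun x ↦ 2 * (x - a) * g x * g' x) volume a b :=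
    (((continuousOn_const.mul (continuousOn_id.sub continuousOn_const)).mul hgc).mul hg').intervalIntegrable_of_Icc hab
  have hi3 : IntervalIntegrable (fun x ↦ (x - a) ^ 2 * g' x ^ 2) volume a b :=
    (((continuousOn_id.sub continuousOn_const).pow 2).mul (hg'.pow 2)).intervalIntegrable_of_Icc hab
  have hftc := intervalIntegral.integral_eq_sub_of_hasDerivAt hprod (hi1.add hi2)
  simp only [hb, sub_self, zero_mul, mul_zero, ne_eq, OfNat.ofNat_ne_zero, not_false_eq_true,
    zero_pow] at hftc
  rw [intervalIntegral.integral_add hi1 hi2] at hftc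
  -- pointwise `−2(x − a)gg' ≤ ½g² + 2(x − a)²g'²`
  have hpt : ∫ x in a..b, -(2 * (x - a) * g x * g' x) ≤ ∫ x in a..b, (1 / 2 * g x ^ 2 + 2 * ((x - a) ^ 2 * g' x ^ 2)) := by
    refine intervalIntegral.integral_mono_on hab hi2.neg ((hi1.const_mul _).add (hi3.const_mul _)) fun x _ ↦ ?_
    nlinarith [sq_nonneg (g x + 2 * (x - a) * g' x)]
  rw [intervalIntegral.integral_neg, intervalIntegral.integral_add (hi1.const_mul _) (hi3.const_mul _),
    intervalIntegral.integral_const_mul, intervalIntegral.integral_const_mul] at hpt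
  linarith

/-! ### The first Hardy inequality on the Kerr–Schild leaves, shell form -/

/-- **First Hardy inequality at the extremal horizon, shell form (Aretakis 2012, Prop. 4.4.1).** For
`Φ ∈ C¹(E4)` vanishing on the outer sphere `{r = R}` of the leaf `{t* = τ}` (`R ≥ M`; e.g. `R`
beyond the support of the wave):
`∫₀^{2π}∫₀^π∫_M^R sin θ Φ(p)² dr dθ dφ ≤ 4 ∫₀^{2π}∫₀^π∫_M^R sin θ (r − M)²(∂_ρΦ)²(p) dr dθ dφ`,
`p = p(τ, r, θ, φ)`, `∂_ρΦ = dΦ(p)(0, n̂)` — the zeroth-order term is controlled by the DEGENERATE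
energy `∫ Δ (Yψ)²`-type quantity (`Δ = (r − M)²`), the mechanism by which the Lagrangian terms of
the modified currents `J^{N,−1/2}` are absorbed (§13.1). [cite: Aretakis2012, §4.4 (Prop. 4.4.1)] -/
theorem shellIntegral_sq_le_four_mul_degenerate {M R τ : ℝ} (hMR : M ≤ R) {Φ : E4 → ℝ}
    (hΦ : ContDiff ℝ 1 Φ) (hfar : ∀ θ φ : ℝ, Φ (shellPoint M τ R θ φ) = 0) :
    shellIntegral M R (fun r θ φ ↦ Real.sin θ * Φ (shellPoint M τ r θ φ) ^ 2) ≤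
      4 * shellIntegral M R (fun r θ φ ↦ Real.sin θ * ((r - M) ^ 2 *
        (fderiv ℝ Φ (shellPoint M τ r θ φ) (E4.spaceEmbed (sphRadial θ φ))) ^ 2)) := by
  have hdiff : Differentiable ℝ Φ := hΦ.differentiable one_ne_zero
  -- the radial derivative as a jointly continuous function
  set D : ℝ → ℝ → ℝ → ℝ := fun r θ φ ↦
    fderiv ℝ Φ (shellPoint M τ r θ φ) (E4.spaceEmbed (sphRadial θ φ)) with hDdef
  have hDc : Continuous fun q : ℝ × ℝ × ℝ ↦ D q.1 q.2.1 q.2.2 :=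
    ((hΦ.continuous_fderiv one_ne_zero).comp (continuous_shellPoint M τ)).clm_apply
      (continuous_spaceEmbed_sphRadial.comp continuous_snd)
  have hΦc : Continuous fun q : ℝ × ℝ × ℝ ↦ Φ (shellPoint M τ q.1 q.2.1 q.2.2) :=
    hΦ.continuous.comp (continuous_shellPoint M τ)
  -- the one-dimensional inequality along each `r`-line
  have h1D : ∀ θ φ : ℝ, (∫ r in M..R, Φ (shellPoint M τ r θ φ) ^ 2) ≤ 4 * ∫ r in M..R, (r - M) ^ 2 * D r θ φ ^ 2 := by
    intro θ φ
    refine intervalIntegral_sq_le_four_mul (g := fun r ↦ Φ (shellPoint M τ r θ φ)) (g' := fun r ↦ D r θ φ) hMR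
      (fun r _ ↦ hasDerivAt_comp_shellPoint (hdiff _)) ?_ (hfar θ φ)
    exact (hDc.comp (Continuous.prodMk continuous_id continuous_const :
      Continuous fun r : ℝ ↦ ((r, θ, φ) : ℝ × ℝ × ℝ))).continuousOn
  -- integrate against `sin θ dθ dφ`
  rw [← shellIntegral_const_mul]
  unfold shellIntegral
  have hsin3 : Continuous fun q : ℝ × ℝ × ℝ ↦ Real.sin q.2.1 := Real.continuous_sin.comp (continuous_fst.comp continuous_snd)
  have hf : Continuous fun q : ℝ × ℝ × ℝ ↦ Real.sin q.2.1 * Φ (shellPoint M τ q.1 q.2.1 q.2.2) ^ 2 :=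
    hsin3.mul (hΦc.pow 2)
  have hg : Continuous fun q : ℝ × ℝ × ℝ ↦ 4 * (Real.sin q.2.1 * ((q.1 - M) ^ 2 * D q.1 q.2.1 q.2.2 ^ 2)) :=
    continuous_const.mul (hsin3.mul (((continuous_fst.sub continuous_const).pow 2).mul (hDc.pow 2)))
  refine sphereIntegral_mono_on (continuous_inner_of_continuous hf) (continuous_inner_of_continuous hg)
    fun θ hθ φ _ ↦ ?_
  have hs : 0 ≤ Real.sin θ := Real.sin_nonneg_of_nonneg_of_le_pi hθ.1 hθ.2
  have e1 : (∫ r in M..R, Real.sin θ * Φ (shellPoint M τ r θ φ) ^ 2) =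
      Real.sin θ * ∫ r in M..R, Φ (shellPoint M τ r θ φ) ^ 2 := intervalIntegral.integral_const_mul _ _
  have e2 : (∫ r in M..R, 4 * (Real.sin θ * ((r - M) ^ 2 * D r θ φ ^ 2))) =
      4 * (Real.sin θ * ∫ r in M..R, (r - M) ^ 2 * D r θ φ ^ 2) := by
    rw [intervalIntegral.integral_const_mul, intervalIntegral.integral_const_mul]
  dsimp only
  rw [e1, e2]
  nlinarith [mul_le_mul_of_nonneg_left (h1D θ φ) hs]

/-! ### The second Hardy inequality: the horizon sphere controlled by a thin layer (trace estimate) -/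

/-- **Second Hardy inequality at the extremal horizon, shell form (Aretakis 2012, Prop. 4.4.2).**
For `Φ ∈ C¹(E4)` and a layer width `δ > 0`:
`∫₀^{2π}∫₀^π sin θ Φ(p_τ)² ≤ (2/δ) ∫₀^{2π}∫₀^π∫_M^{M+δ} sin θ Φ(p)² + 2δ ∫₀^{2π}∫₀^π∫_M^{M+δ} sin θ (∂_ρΦ)²(p)`
(`p_τ = p(τ, M, θ, φ)` the horizon point) — i.e. `∫_{𝓗⁺∩Σ_τ} ψ² ≤ ε ∫_{Σ_τ∩{r ≤ r₀}} (∂_ρψ)² + C_ε ∫ ψ²`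
with `ε = 2δ`, `C_ε = 2/δ`: the trace estimate `Kerr.sq_le_average_of_hasDerivAt`
(`ExtremalHorizonShellEnergyDecay.lean`) along each `r`-line, integrated against `sin θ dθ dφ`.
[cite: Aretakis2012, §4.4 (Prop. 4.4.2)] -/
theorem horizonSphereSq_le_layer {M τ δ : ℝ} (hδ : 0 < δ) {Φ : E4 → ℝ} (hΦ : ContDiff ℝ 1 Φ) :
    (∫ φ in (0 : ℝ)..2 * Real.pi, ∫ θ in (0 : ℝ)..Real.pi, Real.sin θ * Φ (horizonPoint M τ θ φ) ^ 2) ≤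
      2 / δ * shellIntegral M (M + δ) (fun r θ φ ↦ Real.sin θ * Φ (shellPoint M τ r θ φ) ^ 2) +
        2 * δ * shellIntegral M (M + δ) (fun r θ φ ↦ Real.sin θ *
          (fderiv ℝ Φ (shellPoint M τ r θ φ) (E4.spaceEmbed (sphRadial θ φ))) ^ 2) := by
  have hMδ : M < M + δ := by linarith
  have hdiff : Differentiable ℝ Φ := hΦ.differentiable one_ne_zero
  have hDc : Continuous fun q : ℝ × ℝ × ℝ ↦
      fderiv ℝ Φ (shellPoint M τ q.1 q.2.1 q.2.2) (E4.spaceEmbed (sphRadial q.2.1 q.2.2)) :=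
    ((hΦ.continuous_fderiv one_ne_zero).comp (continuous_shellPoint M τ)).clm_apply
      (continuous_spaceEmbed_sphRadial.comp continuous_snd)
  have hΦc : Continuous fun q : ℝ × ℝ × ℝ ↦ Φ (shellPoint M τ q.1 q.2.1 q.2.2) :=
    hΦ.continuous.comp (continuous_shellPoint M τ)
  -- the trace estimate along each `r`-line
  have h1D : ∀ θ φ : ℝ, Φ (horizonPoint M τ θ φ) ^ 2 ≤
      2 / δ * (∫ r in M..(M + δ), Φ (shellPoint M τ r θ φ) ^ 2) + 2 * δ * ∫ r in M..(M + δ),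
        (fderiv ℝ Φ (shellPoint M τ r θ φ) (E4.spaceEmbed (sphRadial θ φ))) ^ 2 := by
    intro θ φ
    have h := sq_le_average_of_hasDerivAt (g := fun r ↦ Φ (shellPoint M τ r θ φ))
      (g' := fun r ↦ fderiv ℝ Φ (shellPoint M τ r θ φ) (E4.spaceEmbed (sphRadial θ φ))) hMδ
      (fun r _ ↦ hasDerivAt_comp_shellPoint (hdiff _))
      ((hDc.comp (Continuous.prodMk continuous_id continuous_const :
        Continuous fun r : ℝ ↦ ((r, θ, φ) : ℝ × ℝ × ℝ))).continuousOn)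
    rw [shellPoint_self, add_sub_cancel_left] at h
    exact h
  -- integrate against `sin θ dθ dφ`
  have hsin3 : Continuous fun q : ℝ × ℝ × ℝ ↦ Real.sin q.2.1 := Real.continuous_sin.comp (continuous_fst.comp continuous_snd)
  have c1 : Continuous fun q : ℝ × ℝ × ℝ ↦ Real.sin q.2.1 * Φ (shellPoint M τ q.1 q.2.1 q.2.2) ^ 2 :=
    hsin3.mul (hΦc.pow 2)
  have c2 : Continuous fun q : ℝ × ℝ × ℝ ↦ Real.sin q.2.1 *
      (fderiv ℝ Φ (shellPoint M τ q.1 q.2.1 q.2.2) (E4.spaceEmbed (sphRadial q.2.1 q.2.2))) ^ 2 :=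
    hsin3.mul (hDc.pow 2)
  have c1' : Continuous fun q : ℝ × ℝ × ℝ ↦ 2 / δ * (Real.sin q.2.1 * Φ (shellPoint M τ q.1 q.2.1 q.2.2) ^ 2) :=
    continuous_const.mul c1
  have c2' : Continuous fun q : ℝ × ℝ × ℝ ↦ 2 * δ * (Real.sin q.2.1 *
      (fderiv ℝ Φ (shellPoint M τ q.1 q.2.1 q.2.2) (E4.spaceEmbed (sphRadial q.2.1 q.2.2))) ^ 2) :=
    continuous_const.mul c2
  have c12 : Continuous fun q : ℝ × ℝ × ℝ ↦ 2 / δ * (Real.sin q.2.1 * Φ (shellPoint M τ q.1 q.2.1 q.2.2) ^ 2) +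
      2 * δ * (Real.sin q.2.1 *
        (fderiv ℝ Φ (shellPoint M τ q.1 q.2.1 q.2.2) (E4.spaceEmbed (sphRadial q.2.1 q.2.2))) ^ 2) :=
    c1'.add c2'
  have key : (∫ φ in (0 : ℝ)..2 * Real.pi, ∫ θ in (0 : ℝ)..Real.pi, Real.sin θ * Φ (horizonPoint M τ θ φ) ^ 2) ≤
      shellIntegral M (M + δ) (fun r θ φ ↦ 2 / δ * (Real.sin θ * Φ (shellPoint M τ r θ φ) ^ 2) +
        2 * δ * (Real.sin θ * (fderiv ℝ Φ (shellPoint M τ r θ φ) (E4.spaceEmbed (sphRadial θ φ))) ^ 2)) := by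
    unfold shellIntegral
    have hlhs : Continuous (Function.uncurry fun θ φ ↦ Real.sin θ * Φ (horizonPoint M τ θ φ) ^ 2) :=
      (Real.continuous_sin.comp continuous_fst).mul ((hΦ.continuous.comp (continuous_horizonPoint_angles M τ)).pow 2)
    refine sphereIntegral_mono_on hlhs (continuous_inner_of_continuous c12) fun θ hθ φ _ ↦ ?_
    have hs : 0 ≤ Real.sin θ := Real.sin_nonneg_of_nonneg_of_le_pi hθ.1 hθ.2
    have m : Continuous fun r : ℝ ↦ ((r, θ, φ) : ℝ × ℝ × ℝ) := Continuous.prodMk continuous_id continuous_const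
    have cr1 : Continuous fun r ↦ 2 / δ * (Real.sin θ * Φ (shellPoint M τ r θ φ) ^ 2) := by
      have h := c1'.comp m
      simp only [Function.comp_def] at h
      exact h
    have cr2 : Continuous fun r ↦ 2 * δ * (Real.sin θ *
        (fderiv ℝ Φ (shellPoint M τ r θ φ) (E4.spaceEmbed (sphRadial θ φ))) ^ 2) := by
      have h := c2'.comp m
      simp only [Function.comp_def] at h
      exact h
    dsimp only
    rw [intervalIntegral.integral_add (cr1.intervalIntegrable _ _) (cr2.intervalIntegrable _ _),
      intervalIntegral.integral_const_mul, intervalIntegral.integral_const_mul,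
      intervalIntegral.integral_const_mul, intervalIntegral.integral_const_mul]
    have h := mul_le_mul_of_nonneg_left (h1D θ φ) hs
    nlinarith [h]
  refine key.trans_eq ?_
  rw [shellIntegral_add (f := fun r θ φ ↦ 2 / δ * (Real.sin θ * Φ (shellPoint M τ r θ φ) ^ 2))
    (g := fun r θ φ ↦ 2 * δ * (Real.sin θ * (fderiv ℝ Φ (shellPoint M τ r θ φ) (E4.spaceEmbed (sphRadial θ φ))) ^ 2))
    c1' c2',
    shellIntegral_const_mul, shellIntegral_const_mul]

end Literature.Barriers.FinalStateConjecture.Kerr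

end
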